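import Literature.Barriers.CriticalPhenomena.PlanarEdwardsModelDiffusive
import Literature.Barriers.CriticalPhenomena.SAPAnisotropicNotDFinite
import HarnessLib

/-!
# Self-avoiding polygons on `ℤ²` as closed step words (haruspicy, layer 1)

Companion of `SAPAnisotropicNotDFinite` (Rechnitzer 2006, *Haruspicy 2*; the named fact
`Rechnitzer2006_thm1`: every row `H_n(x) = Σ_m p_{m,n} x^m` of the anisotropic generating
function of square-lattice self-avoiding polygons is rational with cyclotomic denominator).
The fact file defines `p_{m,n} = polygonCount m n` through `rootedPolygonCount m n`, the number
of pairs (`e` a neighbour of `0`, `ω` a `(N-1)`-step self-avoiding walk of `zdGraph 2` from `0` to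
`e`), `N = 2(m+n) ≥ 4`, whose closed-up polygon has `2m` horizontal bonds (Madras–Slade (3.2.1)).

This file recodes these rooted, oriented polygons as **closed self-avoiding step words**
`w : List (Fin 4)` (`0 = +e₁` (E), `1 = -e₁` (W), `2 = +e₂` (N), `3 = -e₂` (S), the coding
`Edwards2D.stepVec` of `PlanarEdwardsModelDiffusive`, whose bijection `Edwards2D.toWalk` /
`Edwards2D.ofWalk` between step sequences and walks of `zdGraph 2` from `0` is reused):

* `vtx w k` — the vertex after `k` letters; `hcount w` — the number of horizontal letters;
* `IsSAP w` — `|w| ≥ 4`, the word is closed (`Σ` steps `= 0`) and its first `|w|` vertices are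
  pairwise distinct;
* `wordsOfLength N`, `sapWords N h` (the SAP words of length `N` with `h` horizontal letters);
* `rootedPolygonCount_eq_card_sapWords` : `rootedPolygonCount m n = #sapWords (2(m+n)) (2m)`.

All statements here are elementary combinatorics of lattice walks. [folklore]

## References

* A. Rechnitzer, *Haruspicy 2: The anisotropic generating function of self-avoiding polygons is
  not D-finite*, J. Combin. Theory Ser. A 113 (2006) 520–546, §1 (eqs. (2)–(3)) and §2.1.
  [Rechnitzer2006Haruspicy2]
* N. Madras, G. Slade, *The Self-Avoiding Walk* (1993), Definition 3.2.1, eq. (3.2.1).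
  [MadrasSlade1993]
-/

noncomputable section

open Finset SimpleGraph Literature.Probability.LatticeModels Literature.Probability.Percolation
open scoped BigOperators

namespace Literature.Barriers.CriticalPhenomena

namespace Haruspicy

open Edwards2D

/-! ### Unit steps of `ℤ²` -/

/-- The `x`-component of the unit step `a`: `+1, -1, 0, 0` for E, W, N, S. [folklore] -/
theorem stepVec_apply_zero (a : Fin 4) : stepVec a 0 = ![1, -1, 0, 0] a := by
  fin_cases a <;> simp

/-- The `y`-component of the unit step `a`: `0, 0, +1, -1` for E, W, N, S. [folklore] -/
theorem stepVec_apply_one (a : Fin 4) : stepVec a 1 = ![0, 0, 1, -1] a := by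
  fin_cases a <;> simp

/-- `x` and `x + e_a` are nearest neighbours in `zdGraph 2`. [folklore] -/
theorem adj_add_stepVec (x : Site 2) (a : Fin 4) : (zdGraph 2).Adj x (x + stepVec a) := by
  rw [zdGraph_adj_iff]
  fin_cases a
  · exact ⟨0, Or.inl (by simp)⟩
  · exact ⟨0, Or.inr (by simp)⟩
  · exact ⟨1, Or.inl (by simp)⟩
  · exact ⟨1, Or.inr (by simp)⟩

/-- A letter is horizontal (`E` or `W`) iff its step has vanishing `y`-component. [folklore] -/
theorem stepVec_apply_one_eq_zero_iff (a : Fin 4) : stepVec a 1 = 0 ↔ a.val < 2 := by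
  fin_cases a <;> simp

/-- If `x + e_a = 0` then `x` lies on the horizontal axis iff `a` is horizontal. [folklore] -/
theorem apply_one_eq_zero_iff_of_add_stepVec {x : Site 2} {a : Fin 4} (h : x + stepVec a = 0) :
    x 1 = 0 ↔ a.val < 2 := by
  have hx : x 1 = -(stepVec a 1) := by
    have := congrFun h 1
    simp only [Pi.add_apply, Pi.zero_apply] at this
    linarith
  rw [hx, neg_eq_zero, stepVec_apply_one_eq_zero_iff]

/-! ### Step words and their vertices -/

/-- The vertex reached after the first `k` letters of the step word `w` (started at `0`; frozen
at the endpoint for `k ≥ |w|`). [folklore] -/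
def vtx (w : List (Fin 4)) (k : ℕ) : Site 2 :=
  ((w.take k).map stepVec).sum

/-- The walk starts at the origin. [folklore] -/
@[simp] theorem vtx_zero (w : List (Fin 4)) : vtx w 0 = 0 := by
  simp [vtx]

/-- One more letter: `vtx w (k+1) = vtx w k + e_{w_k}`. [folklore] -/
theorem vtx_succ (w : List (Fin 4)) {k : ℕ} (hk : k < w.length) :
    vtx w (k + 1) = vtx w k + stepVec w[k] := by
  unfold vtx
  rw [List.map_take, List.map_take, List.sum_take_succ _ _ (by simpa using hk),
    List.getElem_map]

/-- The endpoint `vtx w |w|` is the sum of all steps. [folklore] -/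
theorem vtx_length (w : List (Fin 4)) : vtx w w.length = (w.map stepVec).sum := by
  simp [vtx]

/-- Past the length the vertex is frozen at the endpoint. [folklore] -/
theorem vtx_of_length_le (w : List (Fin 4)) {k : ℕ} (hk : w.length ≤ k) :
    vtx w k = (w.map stepVec).sum := by
  simp [vtx, List.take_of_length_le hk]

/-- Vertices of a concatenation, first part. [folklore] -/
theorem vtx_append_left (u v : List (Fin 4)) {k : ℕ} (hk : k ≤ u.length) :
    vtx (u ++ v) k = vtx u k := by
  simp [vtx, List.take_append, Nat.sub_eq_zero_of_le hk]

/-- Vertices of a concatenation, second part. [folklore] -/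
theorem vtx_append_add (u v : List (Fin 4)) (k : ℕ) :
    vtx (u ++ v) (u.length + k) = (u.map stepVec).sum + vtx v k := by
  simp [vtx, List.take_length_add_append]

/-- Vertices depend only on the prefix read so far. [folklore] -/
theorem vtx_take (w : List (Fin 4)) {j k : ℕ} (hk : k ≤ j) : vtx (w.take j) k = vtx w k := by
  simp [vtx, List.take_take, min_eq_left hk]

/-- The number of horizontal letters (`E` or `W`) of a step word. [folklore] -/
def hcount (w : List (Fin 4)) : ℕ :=
  w.countP fun a => decide (a.val < 2)

/-- `hcount` is additive under concatenation. [folklore] -/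
theorem hcount_append (u v : List (Fin 4)) : hcount (u ++ v) = hcount u + hcount v := by
  simp [hcount, List.countP_append]

/-- `hcount` of a one-letter word. [folklore] -/
theorem hcount_singleton (a : Fin 4) : hcount [a] = if a.val < 2 then 1 else 0 := by
  simp [hcount]

/-- **SAP words**: closed self-avoiding step words of length at least `4` — the rooted, oriented
self-avoiding polygons of `ℤ²` (root = the origin, orientation = the reading direction).
[cite: MadrasSlade1993, Definition 3.2.1] -/
def IsSAP (w : List (Fin 4)) : Prop :=
  4 ≤ w.length ∧ (w.map stepVec).sum = 0 ∧ Set.InjOn (vtx w) (Set.Iio w.length)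

/-- All step words of length `N`. [folklore] -/
def wordsOfLength (N : ℕ) : Finset (List (Fin 4)) :=
  Finset.univ.image fun f : Fin N → Fin 4 => List.ofFn f

/-- Membership in `wordsOfLength`. [folklore] -/
theorem mem_wordsOfLength {N : ℕ} {w : List (Fin 4)} : w ∈ wordsOfLength N ↔ w.length = N := by
  constructor
  · intro h
    obtain ⟨f, -, rfl⟩ := mem_image.1 h
    simp
  · intro h
    subst h
    exact mem_image.2 ⟨fun i => w[i], mem_univ _, List.ofFn_getElem⟩

open Classical in
/-- The SAP words of length `N` with exactly `h` horizontal letters. [folklore] -/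
def sapWords (N h : ℕ) : Finset (List (Fin 4)) :=
  (wordsOfLength N).filter fun w => IsSAP w ∧ hcount w = h

/-- Membership in `sapWords`. [folklore] -/
theorem mem_sapWords {N h : ℕ} {w : List (Fin 4)} :
    w ∈ sapWords N h ↔ w.length = N ∧ IsSAP w ∧ hcount w = h := by
  classical
  simp [sapWords, mem_wordsOfLength]

/-! ### Bridge to step sequences and to walks of `zdGraph 2` -/

/-- Counting a Boolean over a prefix, one more letter. [folklore] -/
theorem countP_take_succ {α : Type*} (p : α → Bool) (l : List α) {k : ℕ} (hk : k < l.length) :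
    (l.take (k + 1)).countP p = (l.take k).countP p + if p l[k] then 1 else 0 := by
  rw [← List.take_concat_get' l k hk, List.countP_append]
  simp

/-- `horizontalSteps` is invariant under endpoint casts. [folklore] -/
theorem horizontalSteps_copy {u v u' v' : Site 2} (p : (zdGraph 2).Walk u v) (hu : u = u')
    (hv : v = v') : horizontalSteps (p.copy hu hv) = horizontalSteps p := by
  subst hu hv
  rfl

variable {M : ℕ}

/-- The horizontal steps of the walk traced by the first `k` letters of a step sequence are its
horizontal letters among the first `k`. [folklore] -/
theorem horizontalSteps_walkUpTo (ω : StepSeq M) :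
    ∀ k, k ≤ M → horizontalSteps (walkUpTo ω k) =
      ((List.ofFn ω).take k).countP fun a => decide (a.val < 2)
  | 0, _ => by simp [walkUpTo, horizontalSteps, Walk.darts_copy]
  | k + 1, hk => by
      have h : k < M := hk
      have ih := horizontalSteps_walkUpTo ω k h.le
      unfold horizontalSteps at ih ⊢
      rw [walkUpTo, dif_pos h, Walk.darts_concat, List.concat_eq_append, List.countP_append, ih,
        countP_take_succ _ _ (by simp [h])]
      congr 1
      have key : ∀ (x : Site 2) (a : Fin 4), (x 1 = (x + stepVec a) 1 ↔ a.val < 2) := fun x a => by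
        rw [Pi.add_apply, left_eq_add, stepVec_apply_one_eq_zero_iff]
      simp only [List.countP_cons, List.countP_nil, zero_add, List.getElem_ofFn, pos_succ ω h, key]

/-- The horizontal steps of `toWalk ω` are the horizontal letters of `ω`. [folklore] -/
theorem horizontalSteps_toWalk (ω : StepSeq M) :
    horizontalSteps (toWalk ω) = (List.ofFn ω).countP fun a => decide (a.val < 2) := by
  rw [toWalk, horizontalSteps_copy, horizontalSteps_walkUpTo ω M le_rfl,
    List.take_of_length_le (by simp)]

/-- The vertices of the word `List.ofFn ω` are the positions `Edwards2D.pos ω`. [folklore] -/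
theorem vtx_ofFn (ω : StepSeq M) : ∀ k, k ≤ M → vtx (List.ofFn ω) k = pos ω k
  | 0, _ => by simp [pos_zero]
  | k + 1, hk => by
      have h : k < M := hk
      rw [vtx_succ _ (by simp [h]), vtx_ofFn ω k h.le, pos_succ ω h, List.getElem_ofFn]

/-- The steps of `List.ofFn ω` sum to the endpoint of `ω`. [folklore] -/
theorem sum_map_ofFn (ω : StepSeq M) : ((List.ofFn ω).map stepVec).sum = endpoint ω := by
  rw [← vtx_length, List.length_ofFn, vtx_ofFn ω M le_rfl, pos_eq_endpoint]

/-- Closing up a step sequence whose endpoint neighbours the origin: append the step back to `0`.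
[cite: MadrasSlade1993, Definition 3.2.1] -/
def close (ω : StepSeq M) : List (Fin 4) :=
  List.ofFn ω ++ [stepOf (endpoint ω) 0]

/-- Reopening a word: its first `M` letters as a step sequence (junk letters `0` past the end).
[folklore] -/
def unclose (w : List (Fin 4)) : StepSeq M :=
  fun i => w.getD i 0

/-- `close ω` has `M + 1` letters. [folklore] -/
@[simp] theorem length_close (ω : StepSeq M) : (close ω).length = M + 1 := by
  simp [close]

/-- `unclose ∘ close = id`. [folklore] -/
theorem unclose_close (ω : StepSeq M) : unclose (close ω) = ω := by
  funext i
  simp only [unclose, close]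
  rw [List.getD_eq_getElem _ _ (by simp), List.getElem_append_left (by simp)]
  simp

/-- The first `M` letters of `w`, as a list. [folklore] -/
theorem ofFn_unclose (w : List (Fin 4)) (h : M ≤ w.length) :
    List.ofFn (unclose w : StepSeq M) = w.take M := by
  apply List.ext_getElem
  · simp [min_eq_left h]
  · intro i h1 h2
    simp only [List.getElem_ofFn, unclose, List.getElem_take]
    rw [List.getD_eq_getElem _ _ (by simp at h1; omega)]

/-- The positions of the reopened word are the vertices of the word. [folklore] -/
theorem pos_unclose (w : List (Fin 4)) (h : M ≤ w.length) {k : ℕ} (hk : k ≤ M) :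
    pos (unclose w : StepSeq M) k = vtx w k := by
  rw [← vtx_ofFn _ k hk, ofFn_unclose w h, vtx_take w hk]

/-- The endpoint of the reopened word is the vertex `vtx w M`. [folklore] -/
theorem endpoint_unclose (w : List (Fin 4)) (h : M ≤ w.length) :
    endpoint (unclose w : StepSeq M) = vtx w M := by
  rw [← pos_eq_endpoint, pos_unclose w h le_rfl]

/-- A word of length `M + 1` splits as its first `M` letters and its last letter. [folklore] -/
theorem take_append_getElem_last (w : List (Fin 4)) (h : w.length = M + 1) :
    w.take M ++ [w[M]'(by omega)] = w := by
  conv_rhs => rw [← List.take_append_drop M w]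
  rw [List.drop_eq_getElem_cons (by omega), List.drop_of_length_le (by omega)]

/-- For a closed word of length `M + 1`, the last vertex before closing and the last letter
satisfy `vtx w M + e_{w_M} = 0`. [folklore] -/
theorem vtx_add_stepVec_last {w : List (Fin 4)} (h : w.length = M + 1)
    (hc : (w.map stepVec).sum = 0) : vtx w M + stepVec (w[M]'(by omega)) = 0 := by
  rw [← vtx_succ w (by omega), ← h, vtx_length, hc]

/-- `close ∘ unclose = id` on closed words of length `M + 1`. [folklore] -/
theorem close_unclose {w : List (Fin 4)} (h : w.length = M + 1) (hc : (w.map stepVec).sum = 0) :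
    close (unclose w : StepSeq M) = w := by
  rw [close, ofFn_unclose w (by omega), endpoint_unclose w (by omega)]
  conv_rhs => rw [← take_append_getElem_last w h]
  congr 2
  have key := vtx_add_stepVec_last h hc
  conv_lhs => rw [← key]
  exact stepOf_add_stepVec _ _

/-- The vertices of `close ω` up to time `M` are the positions of `ω`. [folklore] -/
theorem vtx_close (ω : StepSeq M) {k : ℕ} (hk : k ≤ M) : vtx (close ω) k = pos ω k := by
  rw [close, vtx_append_left _ _ (by simpa using hk), vtx_ofFn ω k hk]

/-- `close ω` is a closed word when the endpoint of `ω` neighbours the origin. [folklore] -/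
theorem sum_map_close {ω : StepSeq M} (h : (zdGraph 2).Adj (endpoint ω) 0) :
    ((close ω).map stepVec).sum = 0 := by
  simp only [close, List.map_append, List.map_cons, List.map_nil, List.sum_append,
    List.sum_cons, List.sum_nil, add_zero, sum_map_ofFn]
  exact add_stepVec_stepOf h

/-- The horizontal letters of `close ω`. [folklore] -/
theorem hcount_close (ω : StepSeq M) :
    hcount (close ω) = horizontalSteps (toWalk ω) +
      if (stepOf (endpoint ω) 0).val < 2 then 1 else 0 := by
  rw [close, hcount_append, hcount_singleton, horizontalSteps_toWalk]
  rfl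

open Classical in
/-- **Rooted oriented polygons are SAP words**: for every `m, n`, the Madras–Slade count
`rootedPolygonCount m n` (pairs of a neighbour `e` of `0` and a self-avoiding walk `0 → e` of
length `2(m+n) - 1` closing up to a polygon with `2m` horizontal bonds) is the number of SAP words
of length `2(m+n)` with `2m` horizontal letters. [cite: MadrasSlade1993, Definition 3.2.1 and eq. (3.2.1)] -/
theorem rootedPolygonCount_eq_card_sapWords (m n : ℕ) :
    rootedPolygonCount m n = (sapWords (2 * (m + n)) (2 * m)).card := by
  by_cases hmn : m + n < 2
  · rw [rootedPolygonCount, if_pos hmn]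
    symm
    rw [Finset.card_eq_zero, Finset.eq_empty_iff_forall_notMem]
    intro w hw
    rw [mem_sapWords] at hw
    have := hw.2.1.1
    omega
  rw [rootedPolygonCount, if_neg hmn]
  replace hmn : 2 ≤ m + n := not_lt.1 hmn
  -- `N = 2(m+n) = M + 1`
  obtain ⟨M, hM⟩ : ∃ M, 2 * (m + n) = M + 1 := ⟨2 * (m + n) - 1, by omega⟩
  have hM' : 2 * (m + n) - 1 = M := by omega
  rw [hM', hM, ← Finset.card_sigma]
  refine Finset.card_nbij' (fun s => close (ofWalk s.2 M))
    (fun w => ⟨endpoint (unclose w : StepSeq M), toWalk (unclose w : StepSeq M)⟩) ?_ ?_ ?_ ?_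
  · -- forward map lands in SAP words
    rintro ⟨e, p⟩ hs
    simp only [Finset.mem_coe, Finset.mem_sigma, Finset.mem_filter, mem_finsetWalkLength_iff,
      mem_neighborFinset] at hs
    obtain ⟨he, hp, hpath, hhor⟩ := hs
    have hend : endpoint (ofWalk p M) = e := endpoint_ofWalk p hp
    have hadj : (zdGraph 2).Adj (endpoint (ofWalk p M)) 0 := by rw [hend]; exact he.symm
    rw [Finset.mem_coe, mem_sapWords]
    refine ⟨length_close _, ⟨by rw [length_close]; omega, sum_map_close hadj, ?_⟩, ?_⟩
    · intro i hi j hj hij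
      simp only [Set.mem_Iio, length_close] at hi hj
      rw [vtx_close _ (by omega), vtx_close _ (by omega), pos_ofWalk p hp i (by omega),
        pos_ofWalk p hp j (by omega)] at hij
      exact hpath.getVert_injOn (by simp [hp]; omega) (by simp [hp]; omega) hij
    · rw [hcount_close, ← hhor]
      have h1 : horizontalSteps (toWalk (ofWalk p M)) = horizontalSteps p := by
        conv_rhs => rw [← toWalk_ofWalk p hp]
        rw [horizontalSteps_copy]
      have h2 : (stepOf (endpoint (ofWalk p M)) 0).val < 2 ↔ e 1 = 0 := by
        have he1 : e 1 = endpoint (ofWalk p M) 1 := by rw [hend]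
        rw [he1]
        exact (apply_one_eq_zero_iff_of_add_stepVec (add_stepVec_stepOf hadj)).symm
      rw [h1]
      by_cases h3 : e 1 = 0
      · rw [if_pos (h2.2 h3), if_pos h3]
      · rw [if_neg (fun h => h3 (h2.1 h)), if_neg h3]
  · -- backward map lands in the sigma set
    intro w hw
    rw [Finset.mem_coe, mem_sapWords] at hw
    obtain ⟨hlen, ⟨-, hclosed, hinj⟩, hhc⟩ := hw
    have hMle : M ≤ w.length := by omega
    have hend : endpoint (unclose w : StepSeq M) = vtx w M := endpoint_unclose w hMle
    have hlast : vtx w M + stepVec (w[M]'(by omega)) = 0 := vtx_add_stepVec_last hlen hclosed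
    have hadj : (zdGraph 2).Adj (endpoint (unclose w : StepSeq M)) 0 := by
      have := adj_add_stepVec (vtx w M) (w[M]'(by omega))
      rwa [hlast, ← hend] at this
    simp only [Finset.mem_coe, Finset.mem_sigma, Finset.mem_filter, mem_finsetWalkLength_iff,
      mem_neighborFinset]
    refine ⟨hadj.symm, length_toWalk _, ?_, ?_⟩
    · rw [← Walk.IsPath.getVert_injOn_iff]
      intro i hi j hj hij
      simp only [Set.mem_setOf_eq, length_toWalk] at hi hj
      rw [getVert_toWalk _ hi, getVert_toWalk _ hj, pos_unclose w hMle hi,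
        pos_unclose w hMle hj] at hij
      exact hinj (by simp [hlen]; omega) (by simp [hlen]; omega) hij
    · have h2 : (w[M]'(by omega)).val < 2 ↔ endpoint (unclose w : StepSeq M) 1 = 0 := by
        rw [hend, apply_one_eq_zero_iff_of_add_stepVec hlast]
      rw [horizontalSteps_toWalk, ofFn_unclose w hMle, ← hhc]
      conv_rhs => rw [← take_append_getElem_last w hlen, hcount_append, hcount_singleton]
      unfold hcount
      by_cases h3 : (w[M]'(by omega)).val < 2
      · rw [if_pos (h2.1 h3), if_pos h3]
      · rw [if_neg (fun h => h3 (h2.2 h)), if_neg h3]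
  · -- left inverse
    rintro ⟨e, p⟩ hs
    simp only [Finset.mem_coe, Finset.mem_sigma, Finset.mem_filter, mem_finsetWalkLength_iff] at hs
    have hp : p.length = M := hs.2.1
    show (⟨endpoint (unclose (close (ofWalk p M)) : StepSeq M),
        toWalk (unclose (close (ofWalk p M)) : StepSeq M)⟩ : Σ x, (zdGraph 2).Walk 0 x) = ⟨e, p⟩
    rw [unclose_close]
    exact sigma_eq_of_copy_eq _ _ (endpoint_ofWalk p hp) (toWalk_ofWalk p hp)
  · -- right inverse
    intro w hw
    rw [Finset.mem_coe, mem_sapWords] at hw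
    obtain ⟨hlen, ⟨-, hclosed, -⟩, -⟩ := hw
    simp only [ofWalk_toWalk]
    exact close_unclose hlen hclosed

end Haruspicy

end Literature.Barriers.CriticalPhenomena
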